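import Literature.NumberTheory.LFunctions.RodgersTaoIntegratedEnergyBoundProofs
import Literature.NumberTheory.LFunctions.RodgersTaoEnergyV5Proofs
import Literature.NumberTheory.LFunctions.RodgersTaoZerosProofs
import Literature.NumberTheory.LFunctions.ZetaArgVariation
import Literature.NumberTheory.LFunctions.SelbergFujiiSmallGapsProofs
import HarnessLib

/-!
# Rodgers–Tao 2020: the §§3–9 route to `Λ ≥ 0`, by name, modulo Proposition 22, Lemma 24 and the (arXiv v5) energy propagation inequality — RESIDUAL CERTIFICATE

RH-FREE (0 defs / 0 named facts). `rodgers_tao` (`Λ ≥ 0`: no `t < 0` with `H_t` real-rooted,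
Rodgers–Tao 2020 Thm. 1 = arXiv Thm. 1.1) is already a theorem of the tree along Dobner's route
(`rodgers_tao_holds`); the point of this module is its PROOF TERM, which is the Rodgers–Tao route
itself, composed BY NAME: §7 (Thm. 17 from Prop. 22 and Lemma 24,
`rodgers_tao_integrated_energy_bound_of_deriv_lowerBound`, with Lemma 19 and (50) discharged by
content theorems), §8 in its arXiv v5 form (the journal §8 carries an author-acknowledged error
corrected in arXiv v5, whose predicates the tree types as `GoodIntervalBound` and
`EnergyPropagationV5` in `RodgersTaoEnergyV5`: `goodIntervalBound_of_integrated_energy_bound`,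
`energy_bound_zero_of_propagation_v5`, with the regularity inputs discharged by
`rodgers_tao_zeros_ordered`, `rodgers_tao_zeros_continuousOn`), §9 (picket fence and the
pair-correlation contradiction: `rodgers_tao_picket_fence_of_energy_bound`,
`rodgers_tao_of_picket_fence`, with the zeros at time `0`, the Riemann–von Mangoldt formula and the
Selberg–Fujii small gaps discharged in the tree). A constant-reachability walk over the proof terms
confirms that `rodgers_tao_holds` (Dobner) is NOT used anywhere in the cone. The remaining named
hypotheses are exactly Prop. 22 (`rodgers_tao_truncHamiltonian_deriv`), Lemma 24
(`rodgers_tao_truncEnergy_lower_bound`) and the v5 energy propagation inequality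
(`EnergyPropagationV5 t₀` for every witness `t₀`).

LABEL: RH-FREE; bears_on N-C/N-P (COLUMN 3 DBN). WHAT THIS IS NOT: not a new proof of `Λ ≥ 0`
(three named hypotheses remain; `Λ ≥ 0` is Dobner's theorem in the tree); nothing here bears on the
truth of RH.

## References
* [RodgersTaoFMP2020] B. Rodgers, T. Tao, *The de Bruijn–Newman constant is non-negative*, Forum
  Math. Pi 8 (2020), e6 — Thm. 1, §§7–9; arXiv:1801.05914v5 §8 (Props. 8.1–8.3) for the corrected
  energy propagation step.
-/

namespace Literature.NumberTheory.LFunctions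

/-- **The energy bound at time zero from Prop. 22, Lemma 24 and the energy propagation inequality,
§8 in its arXiv v5 form** (the journal §8 carries an author-acknowledged error corrected in arXiv v5;
the tree's v5 predicates are `GoodIntervalBound`, `EnergyPropagationV5` of `RodgersTaoEnergyV5`):
Prop. 22, Lemma 24 and the v5 energy propagation inequality
(`EnergyPropagationV5 t₀` for every witness `t₀`) give the energy bound at time zero
`rodgers_tao_energy_bound_zero`, BY NAME through `rodgers_tao_integrated_energy_bound_of_deriv_lowerBound`,
`goodIntervalBound_of_integrated_energy_bound`, `energy_bound_zero_of_propagation_v5` and the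
regularity discharges `rodgers_tao_zeros_ordered`, `rodgers_tao_zeros_continuousOn`.
[cite: RodgersTaoFMP2020, §8 (= arXiv:1801.05914v5 Props. 8.1–8.3)] -/
theorem rodgers_tao_energy_bound_zero_of_deriv_lowerBound_propagationV5
    (h22 : rodgers_tao_truncHamiltonian_deriv) (h24 : rodgers_tao_truncEnergy_lower_bound)
    (h83 : ∀ t₀ : ℝ, t₀ < 0 → HasOnlyRealZeros (deBruijnH t₀) → EnergyPropagationV5 t₀) :
    rodgers_tao_energy_bound_zero := by
  rintro ⟨t₀, ht₀, hreal⟩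
  have h72 := rodgers_tao_integrated_energy_bound_of_deriv_lowerBound h22 h24
  exact energy_bound_zero_of_propagation_v5 ht₀ (h72 t₀ ht₀ hreal)
    (goodIntervalBound_of_integrated_energy_bound h72 rodgers_tao_zeros_ordered
      rodgers_tao_zeros_continuousOn ht₀ hreal)
    (h83 t₀ ht₀ hreal) (rodgers_tao_zeros_ordered t₀ ht₀ hreal)

/-- **The Rodgers–Tao route to `Λ ≥ 0` with §8 in its arXiv v5 form**, modulo Prop. 22, Lemma 24
and `EnergyPropagationV5`. [cite: RodgersTaoFMP2020, Thm. 1 and §§7–9 (= arXiv:1801.05914v5 Thm. 1.1)] -/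
theorem rodgers_tao_of_deriv_lowerBound_propagationV5
    (h22 : rodgers_tao_truncHamiltonian_deriv) (h24 : rodgers_tao_truncEnergy_lower_bound)
    (h83 : ∀ t₀ : ℝ, t₀ < 0 → HasOnlyRealZeros (deBruijnH t₀) → EnergyPropagationV5 t₀) :
    rodgers_tao :=
  rodgers_tao_of_picket_fence
    (rodgers_tao_picket_fence_of_energy_bound
      (rodgers_tao_energy_bound_zero_of_deriv_lowerBound_propagationV5 h22 h24 h83)
      rodgers_tao_zeros_zero_holds)
    riemann_von_mangoldt_holds selberg_fujii_small_gaps_holds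

end Literature.NumberTheory.LFunctions
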